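import Literature.MathematicalPhysics.QuantumFieldTheory.Balaban1983to89.B1Eq324BenfattoSpecialisation
import HarnessLib

/-!
# `Balaban1983to89.B1Eq324BenfattoEq324Signed` — [Balaban1982Higgs1] (3.24) p. 616 from the Lemma of [BenfattoEtAl1978] p. 152 WITH THE
# SIGNS OF ITS CONSTANTS RECORDED (`0 ≤ S`, `0 < ρ₃`): the adapter between the assembler's explicit-constants knit of the Basic Lemma and the
# `ε`-bookkeeping of `…B1Eq324BenfattoSpecialisation` — PROVED real analysis (two `obtain`s); no new definition, no fact asserted

statement-level companion of a published source with citation tags; every declaration here is a theorem; nothing here is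
a claim about the Yang–Mills mass gap

WHY THIS MODULE (cell `pub-ymgap`, seat `dag-n08-d` gen 10, INTENT-43; node N08 [Balaban1985UV3]; the [BenfattoEtAl1978] source chain behind the
(α)-row `h324c`).  The typed named fact `B1Eq324BenfattoLemma.BasicLemma d α β` quantifies `∃ S ρ₁ ρ₂ ρ₃ ρ₄` with NO sign, while the consumer
`…B1Eq324BenfattoSpecialisation.eq324_of_basicLemma_consts` (B1's sentence «⟨Vⁿ⟩ᵀ = O(εᵏ)|T₁| … n > 6») needs `0 ≤ S` and `0 < ρ₃`
(`…Specialisation.le_errTerm_of_rho3_nonpos`: for `ρ₃ ≤ 0` the printed error does not decay).  The assembler of §5 of [2] (seat `dag-n08-c`,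
`basicLemma_consts`, in flight 2026-08-27) agreed to state the knit with explicit constants and the two signs recorded (bus KNIT-SHAPE-NOTE).  This
file fixes the hand-over SHAPE once: the Lemma p. 152 with signs, as an INLINE hypothesis (the `∃`-package below — no new `def`), implies (i) the
typed `BasicLemma d α β` and (ii) B1 (3.24) in `η`-currency for every truncation order `t` and every exponent `κ < σ(t+1)` — so that the knit,
whatever closed constants it picks, reaches row `h324c`'s in-edge by ONE term `⟨bstar, fun t D ϰ hϰ => ⟨S, ρ₁, ρ₂, ρ₃, ρ₄, hS, hρ₃, h⟩⟩`.

THE SIGNED SHAPE (written inline in every binder below):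
`∃ bstar, ∀ t D ϰ, 0 < ϰ → ∃ S ρ₁ ρ₂ ρ₃ ρ₄, 0 ≤ S ∧ 0 < ρ₃ ∧ ∀ s b, bstar < b → ∀ I J, I.Nonempty → J ⊆ I → ∀ a,
   (∀ C z̄, (∀ x ∈ C, ∀ y ∈ J, b³ ≤ cubeDist x y) → Ineq46 d α β t D s ϰ S ρ₁ ρ₂ ρ₃ ρ₄ b I J C a z̄) ∧ Ineq47 d α β t D s ϰ S ρ₁ ρ₂ ρ₃ ρ₄ b I J a`
— literally the body of `BasicLemma d α β` with `0 ≤ S ∧ 0 < ρ₃` inserted after the inner `∃` (`bstar` a free-field constant, before `t D ϰ`, as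
print's `b* = max{10⁴, γ⁻³b̄}` p. 159).

WHAT IS PROVED (standard axioms; no `sorry`; no definition).
* §1 `basicLemma_of_signed` — the signed shape implies `BasicLemma d α β` (forget the signs); `basicLemmaPrinted_of_signed` — the signed shape for
  `d = 2, 3` and all `α, β > 0` with `E z² = ½` implies `BasicLemmaPrinted`.
* §2 ★★ `eq324_of_basicLemma_signed` — the signed shape implies, for every `t D`, `ϰ > 0`, threshold parameters `b₀ > 0`, `p₀ > 2/3`, coupling power
  `σ > 0`, `c ≥ 0` and every `0 < κ < σ(t+1)`: `∃ η₀ ∈ (0,1], C ≥ 0, ∀ η ∈ (0, η₀], ∀ s, I ⊇ J, I ≠ ∅, a` with `coefSup ≤ c·η^σ`: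
  `0 < ∫Π_Δχ̂_{p(η)}e^{H_J}dP̂₀` and `|log ∫Π_Δχ̂_{p(η)}e^{H_J}dP̂₀ − Σ_{k≤t}ℰ̂₀ᵀ(H_J;k)/k!| ≤ C·η^κ·|I|` (= `eq324_of_basicLemma_consts`).
* §3 `eq324_of_basicLemma_signed_seven` (`t = 6`, `σ = ½`, `κ = 13/4 > 3` — B1's «e.g. n > 6» for d = 3) and `eq324_of_basicLemma_signed_five`
  (`t = 4`, `σ = ½`, `κ = 9/4 > 2`, d = 2).
* §4 (v1.1) «(3.24) MEASURE-FREE»: `pos_and_abs_log_sub_le_of_sandwich` (the log-sandwich for three reals); ★★ `eq324_of_sandwich_consts` — the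
  `η`-bookkeeping with `η₀, C` depending only on `(t, b*, S, ρ₃, b₀, p₀, σ, c, κ)`, the two-sided sandwich a PER-INSTANCE hypothesis for ANY measure
  `μ` at the threshold `p(η)`; `_seven`, `_five`.
HONEST SCOPE.  Adapter only; the signed shape is a HYPOTHESIS here (its proof = §5 of [2], the assembler's knit); `BasicLemmaPrinted` NOT discharged by
this file; the identification of B1's / B10's fluctuation integrals with [2]'s model remains the (α)-row's business (header of `…Specialisation`);
count-neutral for N08; nothing about d = 4, the continuum, OS axioms, a mass gap or the Clay problem.
-/

noncomputable section

open MeasureTheory Finset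

namespace Literature.MathematicalPhysics.QuantumFieldTheory.Balaban1983to89.B1Eq324BenfattoEq324Signed

open Literature.MathematicalPhysics.QuantumFieldTheory.Balaban1983to89.B1Eq324BenfattoLemma
open Literature.MathematicalPhysics.QuantumFieldTheory.Balaban1983to89.B1Eq324BenfattoSpecialisation

variable {d : ℕ} {α β : ℝ}

/-! ## §1  The signed Lemma implies the typed named facts -/

/-- **The Lemma p. 152 with recorded signs implies the typed `BasicLemma d α β`** (forget `0 ≤ S`, `0 < ρ₃`).
[cite: BenfattoEtAl1978, Lemma (4.5)–(4.7) p.152; b* p.159] -/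
theorem basicLemma_of_signed
    (h : ∃ bstar : ℝ, ∀ (t D : ℕ) (ϰ : ℝ), 0 < ϰ → ∃ S ρ₁ ρ₂ ρ₃ ρ₄ : ℝ, 0 ≤ S ∧ 0 < ρ₃ ∧
      ∀ (s : ℕ) (b : ℝ), bstar < b → ∀ (I J : Finset (Fin d → ℤ)), I.Nonempty → J ⊆ I → ∀ a : Coef d,
        (∀ (C : Finset (Fin d → ℤ)) (zbar : (Fin d → ℤ) → ℝ), (∀ x ∈ C, ∀ y ∈ J, b ^ 3 ≤ cubeDist x y) →
            Ineq46 d α β t D s ϰ S ρ₁ ρ₂ ρ₃ ρ₄ b I J C a zbar) ∧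
          Ineq47 d α β t D s ϰ S ρ₁ ρ₂ ρ₃ ρ₄ b I J a) :
    BasicLemma d α β := by
  obtain ⟨bstar, hb⟩ := h
  refine ⟨bstar, fun t D ϰ hϰ => ?_⟩
  obtain ⟨S, ρ₁, ρ₂, ρ₃, ρ₄, -, -, hS⟩ := hb t D ϰ hϰ
  exact ⟨S, ρ₁, ρ₂, ρ₃, ρ₄, hS⟩

/-- **The signed Lemma for the printed dimensions implies `BasicLemmaPrinted`**: if for `d = 2, 3` and every `α, β > 0` with `E z_Δ² = ½` the Lemma
p. 152 holds with recorded signs, the typed named fact AS PRINTED follows. [cite: BenfattoEtAl1978, Lemma p.152 (4.5)–(4.7), Remark 1] -/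
theorem basicLemmaPrinted_of_signed
    (h : ∀ (d : ℕ), (d = 2 ∨ d = 3) → ∀ (α β : ℝ), 0 < α → 0 < β → freeCov d α β 0 0 = 1 / 2 →
      ∃ bstar : ℝ, ∀ (t D : ℕ) (ϰ : ℝ), 0 < ϰ → ∃ S ρ₁ ρ₂ ρ₃ ρ₄ : ℝ, 0 ≤ S ∧ 0 < ρ₃ ∧
        ∀ (s : ℕ) (b : ℝ), bstar < b → ∀ (I J : Finset (Fin d → ℤ)), I.Nonempty → J ⊆ I → ∀ a : Coef d,
          (∀ (C : Finset (Fin d → ℤ)) (zbar : (Fin d → ℤ) → ℝ), (∀ x ∈ C, ∀ y ∈ J, b ^ 3 ≤ cubeDist x y) →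
              Ineq46 d α β t D s ϰ S ρ₁ ρ₂ ρ₃ ρ₄ b I J C a zbar) ∧
            Ineq47 d α β t D s ϰ S ρ₁ ρ₂ ρ₃ ρ₄ b I J a) :
    BasicLemmaPrinted :=
  fun d hd α β hα hβ hE => basicLemma_of_signed (h d hd α β hα hβ hE)

/-! ## §2  B1 (3.24) in `η`-currency from the signed Lemma -/

/-- **[Balaban1982Higgs1] (3.24) p. 616 FROM THE LEMMA p. 152 OF [2] WITH RECORDED SIGNS.**  If the Lemma holds in the signed shape (`0 ≤ S`,
`0 < ρ₃` — the signs print's Remark 4 presupposes), then for every truncation order `t`, degree `D`, decay `ϰ > 0`, threshold parameters `b₀ > 0`,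
`p₀ > 2/3` (`p(η) = b₀(1 + log η⁻¹)^{p₀}`), coupling power `σ > 0`, `c ≥ 0` and every exponent `0 < κ < σ(t+1)` there are `η₀ ∈ (0, 1]`, `C ≥ 0` with:
for all `η ∈ (0, η₀]`, all `s`, `I ⊇ J`, `I ≠ ∅` and coefficient families with `A ≡ sup|coeff| ≤ c·η^σ`,
`0 < ∫Π_Δχ̂_{p(η)}e^{H_J}dP̂₀` and `|log ∫Π_Δχ̂_{p(η)}e^{H_J}dP̂₀ − Σ_{k=1}^{t}ℰ̂₀ᵀ(H_J;k)/k!| ≤ C·η^κ·|I|` — B1's «⟨Vⁿ⟩ᵀ = O(εᵏ)|T₁|».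
Two `obtain`s over `…Specialisation.eq324_of_basicLemma_consts` (the threshold condition `p(η) > b*` is inside `η₀`).
[cite: Balaban1982Higgs1, (3.24) p.616; BenfattoEtAl1978, Lemma p.152, Remark 4] -/
theorem eq324_of_basicLemma_signed
    (h : ∃ bstar : ℝ, ∀ (t D : ℕ) (ϰ : ℝ), 0 < ϰ → ∃ S ρ₁ ρ₂ ρ₃ ρ₄ : ℝ, 0 ≤ S ∧ 0 < ρ₃ ∧
      ∀ (s : ℕ) (b : ℝ), bstar < b → ∀ (I J : Finset (Fin d → ℤ)), I.Nonempty → J ⊆ I → ∀ a : Coef d,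
        (∀ (C : Finset (Fin d → ℤ)) (zbar : (Fin d → ℤ) → ℝ), (∀ x ∈ C, ∀ y ∈ J, b ^ 3 ≤ cubeDist x y) →
            Ineq46 d α β t D s ϰ S ρ₁ ρ₂ ρ₃ ρ₄ b I J C a zbar) ∧
          Ineq47 d α β t D s ϰ S ρ₁ ρ₂ ρ₃ ρ₄ b I J a)
    (t D : ℕ) {ϰ : ℝ} (hϰ : 0 < ϰ) {b₀ p₀ σ c κ : ℝ} (hb₀ : 0 < b₀) (hp₀ : 2 / 3 < p₀) (hσ : 0 < σ) (hc : 0 ≤ c) (hκ : 0 < κ)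
    (hκσ : κ < σ * (t + 1)) :
    ∃ η₀ C : ℝ, 0 < η₀ ∧ η₀ ≤ 1 ∧ 0 ≤ C ∧ ∀ η : ℝ, 0 < η → η ≤ η₀ →
      ∀ (s : ℕ) (I J : Finset (Fin d → ℤ)) (a : Coef d), I.Nonempty → J ⊆ I → coefSup s D a J ≤ c * η ^ σ →
        0 < ∫ z, cutoffBoltzmann (hamiltonian s D ϰ a J) I (B10.pFun b₀ p₀ η) z ∂P0 d α β ∧
          |Real.log (∫ z, cutoffBoltzmann (hamiltonian s D ϰ a J) I (B10.pFun b₀ p₀ η) z ∂P0 d α β) -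
              cumulantSum (P0 d α β) (hamiltonian s D ϰ a J) t| ≤ C * η ^ κ * I.card := by
  obtain ⟨bstar, hb⟩ := h
  obtain ⟨S, ρ₁, ρ₂, ρ₃, ρ₄, hS, hρ₃, hBL⟩ := hb t D ϰ hϰ
  exact eq324_of_basicLemma_consts hBL hS hρ₃ hb₀ hp₀ hσ hc hκ hκσ

/-! ## §3  The printed instances: `t = 6` (d = 3) and `t = 4` (d = 2), coefficients `∝ η^{1/2}` -/

/-- **d = 3, `σ = ½`, `t = n̄ = 6`**: the signed Lemma gives B1's bound with `κ = 13/4 > 3 = d` — *"e.g. n > 6"* (B1 p. 616), *"up to the sixth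
order"* ([Balaban1985UV3] p. 261). [cite: Balaban1982Higgs1, (3.24) p.616; Balaban1985UV3, p.261; BenfattoEtAl1978, Lemma p.152] -/
theorem eq324_of_basicLemma_signed_seven
    (h : ∃ bstar : ℝ, ∀ (t D : ℕ) (ϰ : ℝ), 0 < ϰ → ∃ S ρ₁ ρ₂ ρ₃ ρ₄ : ℝ, 0 ≤ S ∧ 0 < ρ₃ ∧
      ∀ (s : ℕ) (b : ℝ), bstar < b → ∀ (I J : Finset (Fin d → ℤ)), I.Nonempty → J ⊆ I → ∀ a : Coef d,
        (∀ (C : Finset (Fin d → ℤ)) (zbar : (Fin d → ℤ) → ℝ), (∀ x ∈ C, ∀ y ∈ J, b ^ 3 ≤ cubeDist x y) →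
            Ineq46 d α β t D s ϰ S ρ₁ ρ₂ ρ₃ ρ₄ b I J C a zbar) ∧
          Ineq47 d α β t D s ϰ S ρ₁ ρ₂ ρ₃ ρ₄ b I J a)
    (D : ℕ) {ϰ : ℝ} (hϰ : 0 < ϰ) {b₀ p₀ c : ℝ} (hb₀ : 0 < b₀) (hp₀ : 2 / 3 < p₀) (hc : 0 ≤ c) :
    ∃ η₀ C : ℝ, 0 < η₀ ∧ η₀ ≤ 1 ∧ 0 ≤ C ∧ ∀ η : ℝ, 0 < η → η ≤ η₀ →
      ∀ (s : ℕ) (I J : Finset (Fin d → ℤ)) (a : Coef d), I.Nonempty → J ⊆ I →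
        coefSup s D a J ≤ c * η ^ (1 / 2 : ℝ) →
        0 < ∫ z, cutoffBoltzmann (hamiltonian s D ϰ a J) I (B10.pFun b₀ p₀ η) z ∂P0 d α β ∧
          |Real.log (∫ z, cutoffBoltzmann (hamiltonian s D ϰ a J) I (B10.pFun b₀ p₀ η) z ∂P0 d α β) -
              cumulantSum (P0 d α β) (hamiltonian s D ϰ a J) 6| ≤ C * η ^ (13 / 4 : ℝ) * I.card :=
  eq324_of_basicLemma_signed h 6 D hϰ hb₀ hp₀ (by norm_num) hc (by norm_num) (by norm_num)

/-- **d = 2, `σ = ½`, `t = 4`**: the signed Lemma gives B1's bound with `κ = 9/4 > 2 = d`. [cite: Balaban1982Higgs1, (3.24) p.616;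
BenfattoEtAl1978, Lemma p.152] -/
theorem eq324_of_basicLemma_signed_five
    (h : ∃ bstar : ℝ, ∀ (t D : ℕ) (ϰ : ℝ), 0 < ϰ → ∃ S ρ₁ ρ₂ ρ₃ ρ₄ : ℝ, 0 ≤ S ∧ 0 < ρ₃ ∧
      ∀ (s : ℕ) (b : ℝ), bstar < b → ∀ (I J : Finset (Fin d → ℤ)), I.Nonempty → J ⊆ I → ∀ a : Coef d,
        (∀ (C : Finset (Fin d → ℤ)) (zbar : (Fin d → ℤ) → ℝ), (∀ x ∈ C, ∀ y ∈ J, b ^ 3 ≤ cubeDist x y) →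
            Ineq46 d α β t D s ϰ S ρ₁ ρ₂ ρ₃ ρ₄ b I J C a zbar) ∧
          Ineq47 d α β t D s ϰ S ρ₁ ρ₂ ρ₃ ρ₄ b I J a)
    (D : ℕ) {ϰ : ℝ} (hϰ : 0 < ϰ) {b₀ p₀ c : ℝ} (hb₀ : 0 < b₀) (hp₀ : 2 / 3 < p₀) (hc : 0 ≤ c) :
    ∃ η₀ C : ℝ, 0 < η₀ ∧ η₀ ≤ 1 ∧ 0 ≤ C ∧ ∀ η : ℝ, 0 < η → η ≤ η₀ →
      ∀ (s : ℕ) (I J : Finset (Fin d → ℤ)) (a : Coef d), I.Nonempty → J ⊆ I →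
        coefSup s D a J ≤ c * η ^ (1 / 2 : ℝ) →
        0 < ∫ z, cutoffBoltzmann (hamiltonian s D ϰ a J) I (B10.pFun b₀ p₀ η) z ∂P0 d α β ∧
          |Real.log (∫ z, cutoffBoltzmann (hamiltonian s D ϰ a J) I (B10.pFun b₀ p₀ η) z ∂P0 d α β) -
              cumulantSum (P0 d α β) (hamiltonian s D ϰ a J) 4| ≤ C * η ^ (9 / 4 : ℝ) * I.card :=
  eq324_of_basicLemma_signed h 4 D hϰ hb₀ hp₀ (by norm_num) hc (by norm_num) (by norm_num)


/-! ## §4 (v1.1, APPEND-ONLY)  (3.24) MEASURE-FREE: the `η`-bookkeeping with the two-sided sandwich as a per-instance hypothesis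

§§2–3 are keyed to [2]'s free field `P̂₀` through `Ineq46`/`Ineq47`.  The generalised Basic Lemma for the Gaussian field `μ_K` of a CLASS kernel
(the `…KernelSect5*` road of seats n08-b/n08-c/n08-d/n08-w5, our class form of [BenfattoEtAl1978] §5 with [Balaban1985BackgroundPropagators]
Sect. E) ends in the SAME two-sided sandwich `exp(Σ − |I|·S(…)) ≤ ∫Π_Δχ̂_b e^{H_J} dμ_K ≤ exp(Σ + |I|·S(…))`, `Σ = cumulantSum μ_K H_J t`, in the
SAME `errTerm` currency, but for a member on a finite `Λ` with its own admissibility conditions on `(I, J)` (frames inside `Λ`).  The theorem below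
separates the real analysis from the measure: `η₀` and `C` are produced from the constants alone, the threshold `p(η) > b*` is recorded for every
`η ≤ η₀`, and the sandwich at `b = p(η)` is a hypothesis PER INSTANCE `(μ, s, I, J, a)` — any measure, any admissible datum. -/

section MeasureFree

/-- **The log-sandwich for three reals**: `exp(M − E) ≤ Z ≤ exp(M + E)` gives `0 < Z` and `|log Z − M| ≤ E` (a Summits-side twin,
`Summit.QuantumFields.YangMills.Theorems.LogComparisonSmallFieldEnvelope.pos_and_abs_log_sub_le_of_exp_sandwich`, is not importable under `Literature/`).
[folklore] [cite: BenfattoEtAl1978, (4.6)–(4.7) p.152 (the shape)] -/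
theorem pos_and_abs_log_sub_le_of_sandwich {Z M E : ℝ} (hlow : Real.exp (M - E) ≤ Z) (hup : Z ≤ Real.exp (M + E)) :
    0 < Z ∧ |Real.log Z - M| ≤ E := by
  have hpos : 0 < Z := lt_of_lt_of_le (Real.exp_pos _) hlow
  refine ⟨hpos, abs_sub_le_iff.mpr ⟨?_, ?_⟩⟩
  · have := (Real.log_le_iff_le_exp hpos).mpr hup
    linarith
  · have := (Real.le_log_iff_exp_le hpos).mpr hlow
    linarith

/-- The logarithmic factor exceeds any level near `η = 0`: for `a > 0` and every `M` there is `η₀ ∈ (0, 1]` with `M ≤ (1 + log η⁻¹)^a` for all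
`η ∈ (0, η₀]` (private plumbing, as in `…Specialisation`). [folklore] -/
private theorem exists_le_one_add_log_inv_rpow {a : ℝ} (ha : 0 < a) (M : ℝ) :
    ∃ η₀ : ℝ, 0 < η₀ ∧ η₀ ≤ 1 ∧ ∀ η : ℝ, 0 < η → η ≤ η₀ → M ≤ (1 + Real.log η⁻¹) ^ a := by
  set L : ℝ := (max M 1) ^ (1 / a) with hL
  have hL1 : 1 ≤ L := by
    rw [hL]
    exact Real.one_le_rpow (le_max_right _ _) (by positivity)
  refine ⟨Real.exp (1 - L), Real.exp_pos _, ?_, fun η hη hηL => ?_⟩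
  · exact Real.exp_le_one_iff.mpr (by linarith)
  · have hℓ : L ≤ 1 + Real.log η⁻¹ := by
      have h1 : Real.log η ≤ 1 - L := by
        rw [← Real.log_exp (1 - L)]
        exact Real.log_le_log hη hηL
      rw [Real.log_inv]
      linarith
    have hL0 : 0 ≤ L := zero_le_one.trans hL1
    calc M ≤ max M 1 := le_max_left _ _
      _ = L ^ a := by
          rw [hL, ← Real.rpow_mul (le_trans zero_le_one (le_max_right _ _))]
          rw [one_div_mul_cancel ha.ne', Real.rpow_one]
      _ ≤ (1 + Real.log η⁻¹) ^ a := Real.rpow_le_rpow hL0 hℓ ha.le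

/-- ★★ **[Balaban1982Higgs1] (3.24) p. 616 — THE `η`-BOOKKEEPING, MEASURE-FREE.**  Given constants `b*` and `S ≥ 0`, `ρ₁, ρ₂, ρ₃ > 0, ρ₄` (the signs
print's Remark 4 presupposes), threshold parameters `b₀ > 0`, `p₀ > 2/3`, coupling power `σ > 0`, `c ≥ 0`, truncation order `t` and ANY exponent
`0 < κ < σ(t+1)`: there are `η₀ ∈ (0, 1]` and `C ≥ 0` such that for every `η ∈ (0, η₀]` the threshold `p(η) = b₀(1 + log η⁻¹)^{p₀}` exceeds `b*`,
and for EVERY measure `μ` on fields, every `s`, every `I, J` and every coefficient family with `sup|coeff| ≤ c·η^σ`, the two-sided sandwich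
`exp(Σ − |I|·S(…)(p(η))) ≤ ∫Π_Δχ̂_{p(η)} e^{H_J} dμ ≤ exp(Σ + |I|·S(…)(p(η)))`, `Σ = cumulantSum μ H_J t`, implies
`0 < ∫Π_Δχ̂_{p(η)} e^{H_J} dμ` and `|log ∫Π_Δχ̂_{p(η)} e^{H_J} dμ − Σ| ≤ C·η^κ·|I|`.  (`…Specialisation.errTerm_pFun_le` for the decay of the printed
error at the threshold, `exists_le_one_add_log_inv_rpow` for `p(η) > b*`, `pos_and_abs_log_sub_le_of_sandwich`.)  The free-field theorem
`…Specialisation.eq324_of_basicLemma_consts` is the instance `μ = P̂₀` with the sandwich supplied by `Ineq46` at `C = ∅` and `Ineq47`.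
[cite: Balaban1982Higgs1, (3.24) p.616; BenfattoEtAl1978, Lemma p.152, Remark 4 p.153] -/
theorem eq324_of_sandwich_consts {t D : ℕ} {ϰ bstar S ρ₁ ρ₂ ρ₃ ρ₄ b₀ p₀ σ c κ : ℝ}
    (hS : 0 ≤ S) (hρ₃ : 0 < ρ₃) (hb₀ : 0 < b₀) (hp₀ : 2 / 3 < p₀) (hσ : 0 < σ) (hc : 0 ≤ c) (hκ : 0 < κ) (hκσ : κ < σ * (t + 1)) :
    ∃ η₀ C : ℝ, 0 < η₀ ∧ η₀ ≤ 1 ∧ 0 ≤ C ∧ ∀ η : ℝ, 0 < η → η ≤ η₀ →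
      bstar < B10.pFun b₀ p₀ η ∧
      ∀ (μ : Measure ((Fin d → ℤ) → ℝ)) (s : ℕ) (I J : Finset (Fin d → ℤ)) (a : Coef d), coefSup s D a J ≤ c * η ^ σ →
        Real.exp (cumulantSum μ (hamiltonian s D ϰ a J) t -
              (I.card : ℝ) * errTerm S ρ₁ ρ₂ ρ₃ ρ₄ (coefSup s D a J) (B10.pFun b₀ p₀ η) t) ≤
            ∫ z, cutoffBoltzmann (hamiltonian s D ϰ a J) I (B10.pFun b₀ p₀ η) z ∂μ →
        ∫ z, cutoffBoltzmann (hamiltonian s D ϰ a J) I (B10.pFun b₀ p₀ η) z ∂μ ≤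
            Real.exp (cumulantSum μ (hamiltonian s D ϰ a J) t +
              (I.card : ℝ) * errTerm S ρ₁ ρ₂ ρ₃ ρ₄ (coefSup s D a J) (B10.pFun b₀ p₀ η) t) →
        0 < ∫ z, cutoffBoltzmann (hamiltonian s D ϰ a J) I (B10.pFun b₀ p₀ η) z ∂μ ∧
          |Real.log (∫ z, cutoffBoltzmann (hamiltonian s D ϰ a J) I (B10.pFun b₀ p₀ η) z ∂μ) -
              cumulantSum μ (hamiltonian s D ϰ a J) t| ≤ C * η ^ κ * I.card := by
  obtain ⟨η₁, C, hη₁pos, hη₁le, hC, hE⟩ := errTerm_pFun_le ρ₁ ρ₂ ρ₄ t hS hρ₃ hb₀ hp₀ hσ hc hκ hκσ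
  obtain ⟨η₂, hη₂pos, hη₂le, hη₂⟩ :=
    exists_le_one_add_log_inv_rpow (lt_trans (by norm_num) hp₀ : 0 < p₀) ((|bstar| + 1) / b₀)
  refine ⟨min η₁ η₂, C, lt_min hη₁pos hη₂pos, (min_le_left _ _).trans hη₁le, hC, ?_⟩
  intro η hη hηle
  have hηη₁ : η ≤ η₁ := hηle.trans (min_le_left _ _)
  have hηη₂ : η ≤ η₂ := hηle.trans (min_le_right _ _)
  -- the threshold exceeds `b*`
  have hb : bstar < B10.pFun b₀ p₀ η := by
    have hM := hη₂ η hη hηη₂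
    have h1 : |bstar| + 1 ≤ B10.pFun b₀ p₀ η := by
      unfold B10.pFun
      have := mul_le_mul_of_nonneg_left hM hb₀.le
      rwa [mul_div_cancel₀ _ hb₀.ne'] at this
    linarith [le_abs_self bstar]
  refine ⟨hb, fun μ s I J a hA hlow hup => ?_⟩
  obtain ⟨hpos, hsand⟩ := pos_and_abs_log_sub_le_of_sandwich hlow hup
  refine ⟨hpos, hsand.trans ?_⟩
  have herr := hE η (coefSup s D a J) hη hηη₁ (coefSup_nonneg s D a J) hA
  calc (I.card : ℝ) * errTerm S ρ₁ ρ₂ ρ₃ ρ₄ (coefSup s D a J) (B10.pFun b₀ p₀ η) t ≤ (I.card : ℝ) * (C * η ^ κ) :=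
        mul_le_mul_of_nonneg_left herr (Nat.cast_nonneg _)
    _ = C * η ^ κ * I.card := by ring

/-- **`t = 6`, `σ = ½`, `κ = 13/4 > 3`** (B1's «e.g. n > 6» for d = 3; [Balaban1985UV3] p. 261 «up to the sixth order»), measure-free.
[cite: Balaban1982Higgs1, (3.24) p.616; Balaban1985UV3, p.261] -/
theorem eq324_of_sandwich_consts_seven {D : ℕ} {ϰ bstar S ρ₁ ρ₂ ρ₃ ρ₄ b₀ p₀ c : ℝ}
    (hS : 0 ≤ S) (hρ₃ : 0 < ρ₃) (hb₀ : 0 < b₀) (hp₀ : 2 / 3 < p₀) (hc : 0 ≤ c) :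
    ∃ η₀ C : ℝ, 0 < η₀ ∧ η₀ ≤ 1 ∧ 0 ≤ C ∧ ∀ η : ℝ, 0 < η → η ≤ η₀ →
      bstar < B10.pFun b₀ p₀ η ∧
      ∀ (μ : Measure ((Fin d → ℤ) → ℝ)) (s : ℕ) (I J : Finset (Fin d → ℤ)) (a : Coef d), coefSup s D a J ≤ c * η ^ (1 / 2 : ℝ) →
        Real.exp (cumulantSum μ (hamiltonian s D ϰ a J) 6 -
              (I.card : ℝ) * errTerm S ρ₁ ρ₂ ρ₃ ρ₄ (coefSup s D a J) (B10.pFun b₀ p₀ η) 6) ≤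
            ∫ z, cutoffBoltzmann (hamiltonian s D ϰ a J) I (B10.pFun b₀ p₀ η) z ∂μ →
        ∫ z, cutoffBoltzmann (hamiltonian s D ϰ a J) I (B10.pFun b₀ p₀ η) z ∂μ ≤
            Real.exp (cumulantSum μ (hamiltonian s D ϰ a J) 6 +
              (I.card : ℝ) * errTerm S ρ₁ ρ₂ ρ₃ ρ₄ (coefSup s D a J) (B10.pFun b₀ p₀ η) 6) →
        0 < ∫ z, cutoffBoltzmann (hamiltonian s D ϰ a J) I (B10.pFun b₀ p₀ η) z ∂μ ∧
          |Real.log (∫ z, cutoffBoltzmann (hamiltonian s D ϰ a J) I (B10.pFun b₀ p₀ η) z ∂μ) -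
              cumulantSum μ (hamiltonian s D ϰ a J) 6| ≤ C * η ^ (13 / 4 : ℝ) * I.card :=
  eq324_of_sandwich_consts (t := 6) hS hρ₃ hb₀ hp₀ (by norm_num) hc (by norm_num) (by norm_num)

/-- **`t = 4`, `σ = ½`, `κ = 9/4 > 2`** (d = 2), measure-free. [cite: Balaban1982Higgs1, (3.24) p.616] -/
theorem eq324_of_sandwich_consts_five {D : ℕ} {ϰ bstar S ρ₁ ρ₂ ρ₃ ρ₄ b₀ p₀ c : ℝ}
    (hS : 0 ≤ S) (hρ₃ : 0 < ρ₃) (hb₀ : 0 < b₀) (hp₀ : 2 / 3 < p₀) (hc : 0 ≤ c) :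
    ∃ η₀ C : ℝ, 0 < η₀ ∧ η₀ ≤ 1 ∧ 0 ≤ C ∧ ∀ η : ℝ, 0 < η → η ≤ η₀ →
      bstar < B10.pFun b₀ p₀ η ∧
      ∀ (μ : Measure ((Fin d → ℤ) → ℝ)) (s : ℕ) (I J : Finset (Fin d → ℤ)) (a : Coef d), coefSup s D a J ≤ c * η ^ (1 / 2 : ℝ) →
        Real.exp (cumulantSum μ (hamiltonian s D ϰ a J) 4 -
              (I.card : ℝ) * errTerm S ρ₁ ρ₂ ρ₃ ρ₄ (coefSup s D a J) (B10.pFun b₀ p₀ η) 4) ≤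
            ∫ z, cutoffBoltzmann (hamiltonian s D ϰ a J) I (B10.pFun b₀ p₀ η) z ∂μ →
        ∫ z, cutoffBoltzmann (hamiltonian s D ϰ a J) I (B10.pFun b₀ p₀ η) z ∂μ ≤
            Real.exp (cumulantSum μ (hamiltonian s D ϰ a J) 4 +
              (I.card : ℝ) * errTerm S ρ₁ ρ₂ ρ₃ ρ₄ (coefSup s D a J) (B10.pFun b₀ p₀ η) 4) →
        0 < ∫ z, cutoffBoltzmann (hamiltonian s D ϰ a J) I (B10.pFun b₀ p₀ η) z ∂μ ∧
          |Real.log (∫ z, cutoffBoltzmann (hamiltonian s D ϰ a J) I (B10.pFun b₀ p₀ η) z ∂μ) -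
              cumulantSum μ (hamiltonian s D ϰ a J) 4| ≤ C * η ^ (9 / 4 : ℝ) * I.card :=
  eq324_of_sandwich_consts (t := 4) hS hρ₃ hb₀ hp₀ (by norm_num) hc (by norm_num) (by norm_num)

/-- **Sanity: the free-field instance.**  `…Specialisation.eq324_of_basicLemma_consts` re-derived from the measure-free theorem at `μ = P̂₀`,
the sandwich supplied by `Ineq46` at `C = ∅` (`condField_empty`) and `Ineq47`. [cite: Balaban1982Higgs1, (3.24) p.616; BenfattoEtAl1978, Lemma p.152] -/
theorem eq324_of_basicLemma_consts' {t D : ℕ} {ϰ bstar S ρ₁ ρ₂ ρ₃ ρ₄ b₀ p₀ σ c κ : ℝ}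
    (h : ∀ (s : ℕ) (b : ℝ), bstar < b → ∀ (I J : Finset (Fin d → ℤ)), I.Nonempty → J ⊆ I → ∀ a : Coef d,
      (∀ (C : Finset (Fin d → ℤ)) (zbar : (Fin d → ℤ) → ℝ), (∀ x ∈ C, ∀ y ∈ J, b ^ 3 ≤ cubeDist x y) →
          Ineq46 d α β t D s ϰ S ρ₁ ρ₂ ρ₃ ρ₄ b I J C a zbar) ∧
        Ineq47 d α β t D s ϰ S ρ₁ ρ₂ ρ₃ ρ₄ b I J a)
    (hS : 0 ≤ S) (hρ₃ : 0 < ρ₃) (hb₀ : 0 < b₀) (hp₀ : 2 / 3 < p₀) (hσ : 0 < σ) (hc : 0 ≤ c) (hκ : 0 < κ)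
    (hκσ : κ < σ * (t + 1)) :
    ∃ η₀ C : ℝ, 0 < η₀ ∧ η₀ ≤ 1 ∧ 0 ≤ C ∧ ∀ η : ℝ, 0 < η → η ≤ η₀ →
      ∀ (s : ℕ) (I J : Finset (Fin d → ℤ)) (a : Coef d), I.Nonempty → J ⊆ I → coefSup s D a J ≤ c * η ^ σ →
        0 < ∫ z, cutoffBoltzmann (hamiltonian s D ϰ a J) I (B10.pFun b₀ p₀ η) z ∂P0 d α β ∧
          |Real.log (∫ z, cutoffBoltzmann (hamiltonian s D ϰ a J) I (B10.pFun b₀ p₀ η) z ∂P0 d α β) -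
              cumulantSum (P0 d α β) (hamiltonian s D ϰ a J) t| ≤ C * η ^ κ * I.card := by
  obtain ⟨η₀, C, hη₀, hη₀1, hC, hE⟩ :=
    eq324_of_sandwich_consts (d := d) (D := D) (ϰ := ϰ) (bstar := bstar) (ρ₁ := ρ₁) (ρ₂ := ρ₂) (ρ₄ := ρ₄)
      hS hρ₃ hb₀ hp₀ hσ hc hκ hκσ
  refine ⟨η₀, C, hη₀, hη₀1, hC, fun η hη hηle s I J a hI hJI hA => ?_⟩
  obtain ⟨hb, hη⟩ := hE η hη hηle
  obtain ⟨h46, h47⟩ := h s (B10.pFun b₀ p₀ η) hb I J hI hJI a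
  have hup := h46 ∅ (fun _ => 0) fun x hx => absurd hx (Finset.notMem_empty _)
  rw [Ineq46, condField_empty] at hup
  exact hη (P0 d α β) s I J a hA h47 hup

end MeasureFree

end Literature.MathematicalPhysics.QuantumFieldTheory.Balaban1983to89.B1Eq324BenfattoEq324Signed

end
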